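import Summits.CriticalPhenomena.PercolationContinuityZ3.Theorems.SahiBoxTP2MonotonicIff

/-!
# Box-TP₂ ⟺ strongly positively associated ⟺ monotonic — Grimmett's Theorem 2.27 without densities or positivity

Support file of the Sahi cell (`prim-sahi`, typer seat, generation 15; `--supports stmt-CriticalPhenomena-4575`).
Theorems only (no definitions, no named facts, no sorries).

Grimmett (*The Random-Cluster Model*, Thm. 2.27; tree `HolleyCriterion.tfae_strongPosAssoc_lattice_monotonic` for
finite strictly positive weights): FKG lattice condition ⟺ strong positive association (every conditional law given
the configuration off a finite set is positively associated) ⟺ monotonic.  The cell's density-free versions: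
`IsBoxTP2` (generation 11), "monotonic" = boxes in the strong set order are stochastically ordered
(`SahiBoxTP2Conditioning`, converse `SahiBoxTP2MonotonicIff`), and here "strongly positively associated" = **every
law conditioned on a closed box of positive mass is positively associated**.  This file closes the triangle:

* `upper_inter_Icc_mul_le_of_spa`, `upper_inter_lower_inter_Icc_mul_le_of_spa`, **`cond_Icc_mono_of_spa`** —
  strongly PA ⟹ monotonic (the engine of `SahiBoxTP2Conditioning` run on the hypothesis itself: condition on the
  hull `[a₁,b₂]`, test against `{≥ a₂}` and `{≤ b₁}`);
* **`isBoxTP2_of_spa`** — strongly PA ⟹ box-TP₂ (any measurable lattice with measurable rays, finite `μ`);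
* `IsBoxTP2.spa` — box-TP₂ ⟹ strongly PA wherever box-TP₂ probability measures are PA;
* **`isBoxTP2_iff_spa_cube/_hilbert/_real/_spinConfig`** — the equivalences on `Q_d`, `[0,1]^ℕ`, `ℝ^d`, `{−1,+1}^ι`;
  with `isBoxTP2_iff_cond_Icc_mono_…` this is the full density-free Theorem 2.27 for singular / infinite-volume laws.

No sorries, no new axioms.
-/

noncomputable section

namespace Summit.CriticalPhenomena.PercolationContinuityZ3.Theorems.SahiBoxTP2

open MeasureTheory Set Function Literature.Probability.Percolation
open scoped ENNReal unitInterval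

section SPA

variable {Ω : Type*} [MeasurableSpace Ω] [Lattice Ω]

/-- Strongly PA ⟹ unnormalised PA on every box: `μ(U ∩ B) μ(V ∩ B) ≤ μ(U ∩ V ∩ B) μ(B)`. [this work] -/
theorem upper_inter_Icc_mul_le_of_spa {μ : Measure Ω} [IsFiniteMeasure μ]
    (hSPA : ∀ p q : Ω, μ (Icc p q) ≠ 0 → IsPositivelyAssociated ((μ (Icc p q))⁻¹ • μ.restrict (Icc p q)))
    (p q : Ω) {U V : Set Ω} (hU : IsUpperSet U) (hV : IsUpperSet V) (hUm : MeasurableSet U)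
    (hVm : MeasurableSet V) : μ (U ∩ Icc p q) * μ (V ∩ Icc p q) ≤ μ (U ∩ V ∩ Icc p q) * μ (Icc p q) := by
  set B := Icc p q with hB
  by_cases hM0 : μ B = 0
  · rw [measure_inter_null_of_null_right U hM0, zero_mul]
    exact zero_le
  have hMt : μ B ≠ ∞ := measure_ne_top _ _
  have hνapp : ∀ {S : Set Ω}, MeasurableSet S → ((μ B)⁻¹ • μ.restrict B) S = (μ B)⁻¹ * μ (S ∩ B) := fun hS => by
    rw [Measure.smul_apply, smul_eq_mul, Measure.restrict_apply hS]
  have key := (hSPA p q hM0).mul_le_inter hU hV hUm hVm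
  rw [hνapp hUm, hνapp hVm, hνapp (hUm.inter hVm)] at key
  exact mul_le_mul_of_inv_smul hM0 hMt key

/-- Strongly PA ⟹ `μ(U ∩ D ∩ B) μ(B) ≤ μ(U ∩ B) μ(D ∩ B)` for `U` upper, `D` lower. [this work] -/
theorem upper_inter_lower_inter_Icc_mul_le_of_spa {μ : Measure Ω} [IsFiniteMeasure μ]
    (hSPA : ∀ p q : Ω, μ (Icc p q) ≠ 0 → IsPositivelyAssociated ((μ (Icc p q))⁻¹ • μ.restrict (Icc p q)))
    (p q : Ω) {U D : Set Ω} (hU : IsUpperSet U) (hD : IsLowerSet D) (hUm : MeasurableSet U)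
    (hDm : MeasurableSet D) : μ (U ∩ D ∩ Icc p q) * μ (Icc p q) ≤ μ (U ∩ Icc p q) * μ (D ∩ Icc p q) := by
  set B := Icc p q with hB
  by_cases hM0 : μ B = 0
  · rw [hM0, mul_zero]
    exact zero_le
  have hMt : μ B ≠ ∞ := measure_ne_top _ _
  have hνapp : ∀ {S : Set Ω}, MeasurableSet S → ((μ B)⁻¹ • μ.restrict B) S = (μ B)⁻¹ * μ (S ∩ B) := fun hS => by
    rw [Measure.smul_apply, smul_eq_mul, Measure.restrict_apply hS]
  haveI : IsProbabilityMeasure ((μ B)⁻¹ • μ.restrict B) := ⟨by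
    rw [hνapp MeasurableSet.univ, univ_inter, ENNReal.inv_mul_cancel hM0 hMt]⟩
  have key := (hSPA p q hM0).upperSet_lowerSet hU hD hUm hDm
  rw [hνapp hUm, hνapp hDm, hνapp (hUm.inter hDm)] at key
  exact mul_le_mul_of_inv_smul' hM0 hMt key

/-- **Strongly positively associated ⟹ monotonic**: boxes in the strong set order are stochastically ordered.
[this work] -/
theorem cond_Icc_mono_of_spa (hIci : ∀ a : Ω, MeasurableSet (Ici a)) (hIic : ∀ b : Ω, MeasurableSet (Iic b))
    {μ : Measure Ω} [IsFiniteMeasure μ]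
    (hSPA : ∀ p q : Ω, μ (Icc p q) ≠ 0 → IsPositivelyAssociated ((μ (Icc p q))⁻¹ • μ.restrict (Icc p q)))
    {a₁ b₁ a₂ b₂ : Ω} (ha : a₁ ≤ a₂) (hb : b₁ ≤ b₂) {U : Set Ω} (hU : IsUpperSet U) (hUm : MeasurableSet U) :
    μ (U ∩ Icc a₁ b₁) * μ (Icc a₂ b₂) ≤ μ (Icc a₁ b₁) * μ (U ∩ Icc a₂ b₂) := by
  have e1 : Icc a₁ b₁ = Iic b₁ ∩ Icc a₁ b₂ := Set.ext fun x =>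
    ⟨fun hx => ⟨hx.2, hx.1, hx.2.trans hb⟩, fun hx => ⟨hx.2.1, hx.1⟩⟩
  have e2 : Icc a₂ b₂ = Ici a₂ ∩ Icc a₁ b₂ := Set.ext fun x =>
    ⟨fun hx => ⟨hx.1, ha.trans hx.1, hx.2⟩, fun hx => ⟨hx.1, hx.2.2⟩⟩
  have top := upper_inter_Icc_mul_le_of_spa hSPA a₁ b₂ hU (isUpperSet_Ici a₂) hUm (hIci a₂)
  have bot := upper_inter_lower_inter_Icc_mul_le_of_spa hSPA a₁ b₂ hU (isLowerSet_Iic b₁) hUm (hIic b₁)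
  rw [inter_assoc, ← e2] at top
  rw [inter_assoc, ← e1] at bot
  by_cases hM0 : μ (Icc a₁ b₂) = 0
  · have : μ (Icc a₂ b₂) = 0 := measure_mono_null (by rw [e2]; exact inter_subset_right) hM0
    rw [this, mul_zero]
    exact zero_le
  have hMt : μ (Icc a₁ b₂) ≠ ∞ := measure_ne_top _ _
  rw [← ENNReal.mul_le_mul_iff_left hM0 hMt]
  calc μ (U ∩ Icc a₁ b₁) * μ (Icc a₂ b₂) * μ (Icc a₁ b₂)
      = μ (U ∩ Icc a₁ b₁) * μ (Icc a₁ b₂) * μ (Icc a₂ b₂) := by ring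
    _ ≤ μ (U ∩ Icc a₁ b₂) * μ (Icc a₁ b₁) * μ (Icc a₂ b₂) := by gcongr
    _ = μ (Icc a₁ b₁) * (μ (U ∩ Icc a₁ b₂) * μ (Icc a₂ b₂)) := by ring
    _ ≤ μ (Icc a₁ b₁) * (μ (U ∩ Icc a₂ b₂) * μ (Icc a₁ b₂)) := by gcongr
    _ = μ (Icc a₁ b₁) * μ (U ∩ Icc a₂ b₂) * μ (Icc a₁ b₂) := by ring

/-- **Strongly positively associated ⟹ box-TP₂** (any measurable lattice with measurable boxes and rays, finite
`μ`): every box-conditional PA ⟹ monotonic ⟹ box-TP₂. [this work] -/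
theorem isBoxTP2_of_spa (hIci : ∀ a : Ω, MeasurableSet (Ici a)) (hIic : ∀ b : Ω, MeasurableSet (Iic b))
    {μ : Measure Ω} [IsFiniteMeasure μ]
    (hSPA : ∀ p q : Ω, μ (Icc p q) ≠ 0 → IsPositivelyAssociated ((μ (Icc p q))⁻¹ • μ.restrict (Icc p q))) :
    IsBoxTP2 μ :=
  isBoxTP2_of_cond_Icc_mono hIci hIic fun _ _ _ _ ha hb _ hU hUm => cond_Icc_mono_of_spa hIci hIic hSPA ha hb hU hUm

end SPA

section SPA'

variable {Ω : Type*} [MeasurableSpace Ω] [DistribLattice Ω]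

/-- **Box-TP₂ ⟹ strongly positively associated** (distributive measurable lattice in which box-TP₂ probability
measures are positively associated). [this work] -/
theorem IsBoxTP2.spa (hIcc : ∀ a b : Ω, MeasurableSet (Icc a b))
    (hPA : ∀ ν : Measure Ω, IsProbabilityMeasure ν → IsBoxTP2 ν → IsPositivelyAssociated ν) {μ : Measure Ω}
    [IsFiniteMeasure μ] (hμ : IsBoxTP2 μ) (p q : Ω) (h0 : μ (Icc p q) ≠ 0) :
    IsPositivelyAssociated ((μ (Icc p q))⁻¹ • μ.restrict (Icc p q)) :=
  hμ.isPositivelyAssociated_cond_Icc hIcc hPA h0 (measure_ne_top _ _)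

/-- The abstract equivalence: box-TP₂ ⟺ strongly PA, given measurable boxes/rays and PA of box-TP₂ probability
measures. [this work] -/
theorem isBoxTP2_iff_spa (hIcc : ∀ a b : Ω, MeasurableSet (Icc a b)) (hIci : ∀ a : Ω, MeasurableSet (Ici a))
    (hIic : ∀ b : Ω, MeasurableSet (Iic b))
    (hPA : ∀ ν : Measure Ω, IsProbabilityMeasure ν → IsBoxTP2 ν → IsPositivelyAssociated ν) (μ : Measure Ω)
    [IsFiniteMeasure μ] :
    IsBoxTP2 μ ↔ ∀ p q : Ω, μ (Icc p q) ≠ 0 → IsPositivelyAssociated ((μ (Icc p q))⁻¹ • μ.restrict (Icc p q)) :=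
  ⟨fun hμ p q h0 => hμ.spa hIcc hPA p q h0, isBoxTP2_of_spa hIci hIic⟩

end SPA'

/-! ### The equivalences in the four settings -/

section Iff

variable {d : ℕ}

/-- **`Q_d`: box-TP₂ ⟺ every law conditioned on a closed box of positive mass is positively associated.**
[this work] -/
theorem isBoxTP2_iff_spa_cube (μ : Measure (Fin d → I)) [IsFiniteMeasure μ] :
    IsBoxTP2 μ ↔ ∀ p q : Fin d → I, μ (Icc p q) ≠ 0 →
      IsPositivelyAssociated ((μ (Icc p q))⁻¹ • μ.restrict (Icc p q)) :=
  isBoxTP2_iff_spa (fun _ _ => measurableSet_Icc) (fun _ => measurableSet_Ici) (fun _ => measurableSet_Iic)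
    (fun ν _ hν => hν.isPositivelyAssociated_cube ν) μ

/-- **Hilbert cube: box-TP₂ ⟺ strongly positively associated.** [this work] -/
theorem isBoxTP2_iff_spa_hilbert (μ : Measure (ℕ → I)) [IsFiniteMeasure μ] :
    IsBoxTP2 μ ↔ ∀ p q : ℕ → I, μ (Icc p q) ≠ 0 →
      IsPositivelyAssociated ((μ (Icc p q))⁻¹ • μ.restrict (Icc p q)) :=
  isBoxTP2_iff_spa (fun _ _ => measurableSet_Icc) (fun _ => measurableSet_Ici) (fun _ => measurableSet_Iic)
    (fun ν _ hν => hν.isPositivelyAssociated_hilbert ν) μ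

/-- **`ℝ^d`: box-TP₂ ⟺ strongly positively associated.** [this work] -/
theorem isBoxTP2_iff_spa_real (μ : Measure (Fin d → ℝ)) [IsFiniteMeasure μ] :
    IsBoxTP2 μ ↔ ∀ p q : Fin d → ℝ, μ (Icc p q) ≠ 0 →
      IsPositivelyAssociated ((μ (Icc p q))⁻¹ • μ.restrict (Icc p q)) :=
  isBoxTP2_iff_spa (fun _ _ => measurableSet_Icc) (fun _ => measurableSet_Ici) (fun _ => measurableSet_Iic)
    (fun ν _ hν => hν.isPositivelyAssociated_real ν) μ

/-- **`{−1,+1}^ι` (`ι` countably infinite): box-TP₂ ⟺ every law conditioned on a cylinder box of positive mass is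
positively associated** — with `isBoxTP2_iff_cond_Icc_mono_spinConfig`, Grimmett's Theorem 2.27 for
infinite-volume laws, density-free, no positivity assumption. [this work] -/
theorem isBoxTP2_iff_spa_spinConfig {ι : Type*} [Countable ι] [Infinite ι] (μ : Measure (ι → ℤˣ))
    [IsFiniteMeasure μ] :
    IsBoxTP2 μ ↔ ∀ p q : ι → ℤˣ, μ (Icc p q) ≠ 0 →
      IsPositivelyAssociated ((μ (Icc p q))⁻¹ • μ.restrict (Icc p q)) :=
  isBoxTP2_iff_spa measurableSet_Icc_spinConfig measurableSet_Ici_spinConfig measurableSet_Iic_spinConfig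
    (fun ν _ hν => hν.isPositivelyAssociated_spinConfig ν) μ

end Iff

end Summit.CriticalPhenomena.PercolationContinuityZ3.Theorems.SahiBoxTP2
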